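import Summits.RiemannHypothesis.RiemannHypothesis.Theorems.HandoffDecomposition
import Summits.RiemannHypothesis.RiemannHypothesis.Theorems.HandoffCross
import Summits.RiemannHypothesis.RiemannHypothesis.Theorems.HandoffAnalytic
import HarnessLib

/-!
# HANDOFF — «EVEN CARRIES THE MARGIN» AS AN INEQUALITY: on the layer the new prime's reward of an EVEN function is CUBIC in the offset, of an ODD function LINEAR (cell rh-explicit, TRACK «HANDOFF», seat theory-2 gen8, file XII-t)

HONEST FRAMING. Nothing here bears on the truth of RH; every statement is RH-free calculus on the layer. No certificate is proved.

For a prime `q`, `L = log q`, and a Weil test function `g` on `[−b, b]` with `b = L/2 + δ` in `q`'s window, the contribution of the place `q`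
is a LAYER quantity (`HandoffEntranceSignLayer`, `HandoffMirrorPolarization`): writing `σ u = L − u` for the mirror about the entrance point
`L/2` and `Λ = [L − b, b]` (width `2δ`) for the layer,

  even `g`:  `contribution_q(g) = (log q/(2√q))·(∫_Λ ‖g − g∘σ‖² − ∫_Λ ‖g + g∘σ‖²)`   (`contribution_even_eq_layer_polar`),
  odd  `g`:  `contribution_q(g) = (log q/(2√q))·(∫_Λ ‖g + g∘σ‖² − ∫_Λ ‖g − g∘σ‖²)`   (`contribution_odd_eq_layer_polar`).

So the reward available to an EVEN function is bounded by its mirror-ANTISYMMETRIC mass on the layer, `∫_Λ ‖g(u) − g(L − u)‖² du`, which for a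
function of slope `≤ M` on `Λ` is `≤ M²∫_Λ (2u − L)² du = (8/3)·M²·δ³` (mean value inequality): **`contribution_q(g) ≤ (4/3)(log q/√q)·M²·δ³`**
(`contribution_even_le_cubic`) — CUBIC in the offset; whereas an odd function is rewarded through its mirror-SYMMETRIC mass, bounded only by
`4∫_Λ ‖g‖² ≤ 8δ·K²` for `‖g‖ ≤ K` on `Λ`: **`contribution_q(g) ≤ 4(log q/√q)·K²·δ`** (`contribution_odd_le_linear`) — LINEAR in the offset, and
attained up to the constant by the odd Cramér pairs of XII-k (`contribution = cap(q)‖g‖²`).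

CONSEQUENCE on the window (`q < q'` consecutive, `b ≤ (log q')/2`, where `Re Q = contribution_q − deficit_q`, `deficit_q = −Re Q_{S_q}`):
**`Re Q_{S_q}(g) ≥ Re Q(g) − (4/3)(log q/√q)·M²·δ³`** for even `g` of slope `≤ M` on the layer (`re_semilocal_ge_of_even_slope`); hence under the
certificate `0 ≤ ε_ev(b)` (or RH) the EVEN sector of the deleted form can be negative at offset `δ` only by `(4/3)(log q/√q)·M²·δ³`
(`re_semilocal_ge_neg_cubic_of_even`), and an even NEGATIVE WITNESS must have slope `M² > (3√q/(4 log q))·ε_ev(b)‖g‖₂²/δ³` somewhere on the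
layer (`slope_lower_bound_of_even_neg`) — the quantitative face of XII-p's node (a node at `L/2 + δ/4` inside a layer of width `2δ` forces a
slope). For ODD `g` the corresponding floor is only LINEAR: `Re Q_{S_q}(g) ≥ Re Q(g) − 4(log q/√q)·K²·δ` (`re_semilocal_ge_of_odd_sup`).
This is «odd carries the wall, even carries the margin» (HANDOFF-STATEMENT §H.2; EDGESIGN REPORT §3b: δ_ev ≈ 3.2·δ*, DATA) as a pair of
kernel inequalities with the powers `δ¹` versus `δ³` explicit. MODEL-free; the numbers 3.2 and 1/4 are NOT derived here.

References: A. Connes, C. Consani, Enseign. Math. 69 (2023) §2.1.3, §2.2–2.3 (semi-local form, parity) [ConnesConsani2023]; E. Bombieri,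
Rend. Mat. Acc. Lincei (9) 11 (2000) Thm 2, §4 [Bombieri2000Weil]; H. Yoshida, Adv. Stud. Pure Math. 21 (1992) §2 (2.1) [Yoshida1992HermitianForms].
-/

set_option linter.dupNamespace false

noncomputable section

open Complex Set MeasureTheory Literature.NumberTheory.LFunctions
open Summit.RiemannHypothesis.RiemannHypothesis.Theorems.Handoff
open Summit.RiemannHypothesis.RiemannHypothesis.Theorems.HandoffDecomposition (contribution_eq_two_mul)
open scoped ComplexConjugate

namespace Summit.RiemannHypothesis.RiemannHypothesis.Theorems.HandoffEvenRescueCubic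

variable {g : ℝ → ℂ} {q q' : ℕ} {b M K : ℝ}

/-! ## §1 The layer polar forms -/

/-- The contribution as the real part of a LAYER integral against the mirror copy, for `g` on `[−b, b]`:
`contribution_q(g) = −(2 log q/√q)·Re ∫_{[L − b, b]} g(u)·conj g(u − L) du`, `L = log q` (outside the layer one factor vanishes).
Re-derived here (the landed `HandoffMirrorPolarization.contribution_eq_layer` is not yet importable on the farm); stated with the
integrand's support made explicit. [cite: ConnesConsani2023, §2.2–§2.3] -/
theorem contribution_eq_re_layer (hsupp : tsupport g ⊆ Icc (-b) b) :
    contribution q g + 2 * Real.log q / Real.sqrt q *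
      (∫ u in Icc (Real.log q - b) b, g u * conj (g (u - Real.log q))).re = 0 := by
  have hset : ∫ u : ℝ, g u * conj (g (u - Real.log q)) = ∫ u in Icc (Real.log q - b) b, g u * conj (g (u - Real.log q)) := by
    refine (setIntegral_eq_integral_of_forall_compl_eq_zero fun u hu ↦ ?_).symm
    simp only [mem_Icc, not_and_or, not_le] at hu
    rcases hu with h | h
    · have : g (u - Real.log q) = 0 := image_eq_zero_of_notMem_tsupport fun hm ↦ by have := (hsupp hm).1; linarith
      rw [this, map_zero, mul_zero]
    · have : g u = 0 := image_eq_zero_of_notMem_tsupport fun hm ↦ by have := (hsupp hm).2; linarith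
      rw [this, zero_mul]
  rw [contribution_eq_two_mul, weilConv_weilReflect_eq_integral, hset]
  ring

/-- Integrability of `‖g ± g∘σ‖²`-type layer integrands (continuous on a compact interval). [folklore] -/
theorem integrableOn_normSq_layer (hg : IsWeilTest g) (F : ℂ → ℂ → ℂ) (hF : Continuous fun p : ℂ × ℂ ↦ F p.1 p.2) (L a c : ℝ) :
    IntegrableOn (fun u : ℝ ↦ ‖F (g u) (g (L - u))‖ ^ 2) (Icc a c) := by
  have hc : Continuous fun u : ℝ ↦ ‖F (g u) (g (L - u))‖ ^ 2 :=
    ((hF.comp (hg.1.continuous.prodMk (hg.1.continuous.comp (continuous_const.sub continuous_id)))).norm).pow 2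
  exact hc.continuousOn.integrableOn_Icc

/-- **EVEN, layer polar form**: `contribution_q(g) = (log q/(2√q))·(∫_Λ ‖g − g∘σ‖² − ∫_Λ ‖g + g∘σ‖²)`, `Λ = [log q − b, b]`, `σ u = log q − u`.
[cite: ConnesConsani2023, §2.1.3 (parity), §2.2–2.3] -/
theorem contribution_even_eq_layer_polar (hg : IsWeilTest g) (hsupp : tsupport g ⊆ Icc (-b) b) (hev : ∀ t, g (-t) = g t) :
    contribution q g = Real.log q / (2 * Real.sqrt q) *
      ((∫ u in Icc (Real.log q - b) b, ‖g u - g (Real.log q - u)‖ ^ 2) -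
        ∫ u in Icc (Real.log q - b) b, ‖g u + g (Real.log q - u)‖ ^ 2) := by
  have h0 := contribution_eq_re_layer (q := q) hsupp
  have e : (fun u : ℝ ↦ g u * conj (g (u - Real.log q))) = fun u ↦ g u * conj (g (Real.log q - u)) := by
    funext u; rw [← hev (u - Real.log q), neg_sub]
  rw [e] at h0
  have hprod : IntegrableOn (fun u : ℝ ↦ g u * conj (g (Real.log q - u))) (Icc (Real.log q - b) b) :=
    (hg.1.continuous.mul (Complex.continuous_conj.comp
      (hg.1.continuous.comp (continuous_const.sub continuous_id)))).continuousOn.integrableOn_Icc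
  have hre := integral_re hprod
  rw [RCLike.re_eq_complex_re] at hre
  have hpt : ∀ u : ℝ, ((fun u : ℝ ↦ g u * conj (g (Real.log q - u))) u).re =
      (‖g u + g (Real.log q - u)‖ ^ 2 - ‖g u - g (Real.log q - u)‖ ^ 2) / 4 := fun u ↦ by
    rw [← Complex.normSq_eq_norm_sq, ← Complex.normSq_eq_norm_sq, Complex.normSq_add, Complex.normSq_sub]
    simp only [Complex.mul_re, Complex.conj_re, Complex.conj_im]
    ring
  simp_rw [hpt] at hre
  rw [integral_div, integral_sub (integrableOn_normSq_layer hg (· + ·) (by fun_prop) _ _ _)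
    (integrableOn_normSq_layer hg (· - ·) (by fun_prop) _ _ _)] at hre
  rw [← hre] at h0
  linear_combination h0

/-- **ODD, layer polar form**: `contribution_q(g) = (log q/(2√q))·(∫_Λ ‖g + g∘σ‖² − ∫_Λ ‖g − g∘σ‖²)`. [cite: ConnesConsani2023, §2.1.3, §2.2–2.3] -/
theorem contribution_odd_eq_layer_polar (hg : IsWeilTest g) (hsupp : tsupport g ⊆ Icc (-b) b) (hodd : ∀ t, g (-t) = -g t) :
    contribution q g = Real.log q / (2 * Real.sqrt q) *
      ((∫ u in Icc (Real.log q - b) b, ‖g u + g (Real.log q - u)‖ ^ 2) -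
        ∫ u in Icc (Real.log q - b) b, ‖g u - g (Real.log q - u)‖ ^ 2) := by
  have h0 := contribution_eq_re_layer (q := q) hsupp
  have e : (fun u : ℝ ↦ g u * conj (g (u - Real.log q))) = fun u ↦ -(g u * conj (g (Real.log q - u))) := by
    funext u; rw [← neg_sub (Real.log q) u, hodd (Real.log q - u), map_neg, mul_neg]
  rw [e, integral_neg, Complex.neg_re] at h0
  have hprod : IntegrableOn (fun u : ℝ ↦ g u * conj (g (Real.log q - u))) (Icc (Real.log q - b) b) :=
    (hg.1.continuous.mul (Complex.continuous_conj.comp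
      (hg.1.continuous.comp (continuous_const.sub continuous_id)))).continuousOn.integrableOn_Icc
  have hre := integral_re hprod
  rw [RCLike.re_eq_complex_re] at hre
  have hpt : ∀ u : ℝ, ((fun u : ℝ ↦ g u * conj (g (Real.log q - u))) u).re =
      (‖g u + g (Real.log q - u)‖ ^ 2 - ‖g u - g (Real.log q - u)‖ ^ 2) / 4 := fun u ↦ by
    rw [← Complex.normSq_eq_norm_sq, ← Complex.normSq_eq_norm_sq, Complex.normSq_add, Complex.normSq_sub]
    simp only [Complex.mul_re, Complex.conj_re, Complex.conj_im]
    ring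
  simp_rw [hpt] at hre
  rw [integral_div, integral_sub (integrableOn_normSq_layer hg (· + ·) (by fun_prop) _ _ _)
    (integrableOn_normSq_layer hg (· - ·) (by fun_prop) _ _ _)] at hre
  rw [← hre] at h0
  linear_combination h0

/-- EVEN: the reward is at most the mirror-ANTISYMMETRIC layer mass, `contribution_q(g) ≤ (log q/(2√q))·∫_Λ ‖g − g∘σ‖²`. [this track] -/
theorem contribution_even_le_layer (hg : IsWeilTest g) (hsupp : tsupport g ⊆ Icc (-b) b) (hev : ∀ t, g (-t) = g t) :
    contribution q g ≤ Real.log q / (2 * Real.sqrt q) * ∫ u in Icc (Real.log q - b) b, ‖g u - g (Real.log q - u)‖ ^ 2 := by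
  rw [contribution_even_eq_layer_polar hg hsupp hev, mul_sub]
  have h0 : 0 ≤ ∫ u in Icc (Real.log q - b) b, ‖g u + g (Real.log q - u)‖ ^ 2 := integral_nonneg fun u ↦ by positivity
  nlinarith [(div_nonneg (Real.log_natCast_nonneg q) (mul_nonneg zero_le_two (Real.sqrt_nonneg _)) : 0 ≤ Real.log q / (2 * Real.sqrt q))]

/-- ODD: the reward is at most the mirror-SYMMETRIC layer mass, `contribution_q(g) ≤ (log q/(2√q))·∫_Λ ‖g + g∘σ‖²`. [this track] -/
theorem contribution_odd_le_layer (hg : IsWeilTest g) (hsupp : tsupport g ⊆ Icc (-b) b) (hodd : ∀ t, g (-t) = -g t) :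
    contribution q g ≤ Real.log q / (2 * Real.sqrt q) * ∫ u in Icc (Real.log q - b) b, ‖g u + g (Real.log q - u)‖ ^ 2 := by
  rw [contribution_odd_eq_layer_polar hg hsupp hodd, mul_sub]
  have h0 : 0 ≤ ∫ u in Icc (Real.log q - b) b, ‖g u - g (Real.log q - u)‖ ^ 2 := integral_nonneg fun u ↦ by positivity
  nlinarith [(div_nonneg (Real.log_natCast_nonneg q) (mul_nonneg zero_le_two (Real.sqrt_nonneg _)) : 0 ≤ Real.log q / (2 * Real.sqrt q))]

/-! ## §2 The cubic bound (even) and the linear bound (odd) -/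

/-- `∫_{[L − b, b]} (2u − L)² du = (8/3)·(b − L/2)³` for `L/2 ≤ b` (the layer's second moment about the entrance point). [folklore] -/
theorem integral_sq_layer {L : ℝ} (hb : L / 2 ≤ b) :
    ∫ u in Icc (L - b) b, (2 * u - L) ^ 2 = 8 / 3 * (b - L / 2) ^ 3 := by
  have hle : L - b ≤ b := by linarith
  rw [integral_Icc_eq_integral_Ioc, ← intervalIntegral.integral_of_le hle]
  have hderiv : ∀ u ∈ Set.uIcc (L - b) b, HasDerivAt (fun u : ℝ ↦ (2 * u - L) ^ 3 / 6) ((2 * u - L) ^ 2) u := by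
    intro u _
    have h1 : HasDerivAt (fun u : ℝ ↦ 2 * u - L) 2 u := by
      simpa using ((hasDerivAt_id' u).const_mul (2 : ℝ)).sub_const L
    refine ((h1.pow 3).div_const 6).congr_deriv ?_
    push_cast
    ring
  rw [intervalIntegral.integral_eq_sub_of_hasDerivAt hderiv ((continuous_const.mul continuous_id).sub continuous_const |>.pow 2
    |>.intervalIntegrable _ _)]
  ring

/-- Mean value on the layer: slope `≤ M` on `Λ = [L − b, b]` gives `‖g(u) − g(L − u)‖ ≤ M·|2u − L|` for `u ∈ Λ` (both `u` and `L − u` lie in the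
convex set `Λ`). [folklore] -/
theorem norm_sub_mirror_le_of_slope (hg : IsWeilTest g) {L : ℝ} (hM : ∀ u ∈ Icc (L - b) b, ‖deriv g u‖ ≤ M)
    {u : ℝ} (hu : u ∈ Icc (L - b) b) : ‖g u - g (L - u)‖ ≤ M * |2 * u - L| := by
  have hu' : L - u ∈ Icc (L - b) b := ⟨by linarith [hu.2], by linarith [hu.1]⟩
  have hdiff : ∀ x ∈ Icc (L - b) b, DifferentiableAt ℝ g x := fun x _ ↦
    (hg.1.differentiable (by simp)).differentiableAt
  have h := (convex_Icc (L - b) b).norm_image_sub_le_of_norm_deriv_le hdiff hM hu' hu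
  have e : u - (L - u) = 2 * u - L := by ring
  rwa [e, Real.norm_eq_abs] at h

/-- **THE CUBIC BOUND (even).** For even `g` on `[−b, b]`, `b ≥ (log q)/2`, with slope `‖g′‖ ≤ M` on the layer `[log q − b, b]`:
`contribution_q(g) ≤ (4/3)·(log q/√q)·M²·δ³`, `δ = b − (log q)/2`. The new prime can reward an even function only in proportion to the CUBE
of the offset — «even carries the margin». [this track; cf. ConnesConsani2023 §2.1.3] -/
theorem contribution_even_le_cubic (hg : IsWeilTest g) (hsupp : tsupport g ⊆ Icc (-b) b) (hev : ∀ t, g (-t) = g t)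
    (hb : Real.log q / 2 ≤ b) (hM : ∀ u ∈ Icc (Real.log q - b) b, ‖deriv g u‖ ≤ M) :
    contribution q g ≤ 4 / 3 * (Real.log q / Real.sqrt q) * M ^ 2 * (b - Real.log q / 2) ^ 3 := by
  have hMnn : 0 ≤ M := by
    have hmem : b ∈ Icc (Real.log q - b) b := ⟨by linarith, le_rfl⟩
    exact (norm_nonneg _).trans (hM b hmem)
  have hint : (∫ u in Icc (Real.log q - b) b, ‖g u - g (Real.log q - u)‖ ^ 2) ≤
      ∫ u in Icc (Real.log q - b) b, M ^ 2 * (2 * u - Real.log q) ^ 2 := by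
    refine setIntegral_mono_on (integrableOn_normSq_layer hg (· - ·) (by fun_prop) _ _ _)
      ((continuous_const.mul (((continuous_const.mul continuous_id).sub continuous_const).pow 2)).continuousOn.integrableOn_Icc)
      measurableSet_Icc fun u hu ↦ ?_
    have h := norm_sub_mirror_le_of_slope hg hM hu
    have h2 : ‖g u - g (Real.log q - u)‖ ^ 2 ≤ (M * |2 * u - Real.log q|) ^ 2 :=
      pow_le_pow_left₀ (norm_nonneg _) h 2
    rw [mul_pow, sq_abs] at h2
    exact h2
  rw [integral_const_mul, integral_sq_layer hb] at hint
  have hw : 0 ≤ Real.log q / (2 * Real.sqrt q) :=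
    div_nonneg (Real.log_natCast_nonneg q) (mul_nonneg zero_le_two (Real.sqrt_nonneg _))
  calc contribution q g ≤ Real.log q / (2 * Real.sqrt q) * ∫ u in Icc (Real.log q - b) b, ‖g u - g (Real.log q - u)‖ ^ 2 :=
        contribution_even_le_layer hg hsupp hev
    _ ≤ Real.log q / (2 * Real.sqrt q) * (M ^ 2 * (8 / 3 * (b - Real.log q / 2) ^ 3)) := mul_le_mul_of_nonneg_left hint hw
    _ = 4 / 3 * (Real.log q / Real.sqrt q) * M ^ 2 * (b - Real.log q / 2) ^ 3 := by ring

/-- **THE LINEAR BOUND (odd).** For odd `g` on `[−b, b]`, `b ≥ (log q)/2`, with `‖g‖ ≤ K` on the layer: `contribution_q(g) ≤ 4·(log q/√q)·K²·δ`,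
`δ = b − (log q)/2` (`‖g + g∘σ‖² ≤ 4K²` pointwise on a layer of width `2δ`). Up to the constant this is attained (XII-k's odd Cramér pairs draw
`cap(q)‖g‖₂²`). [this track] -/
theorem contribution_odd_le_linear (hg : IsWeilTest g) (hsupp : tsupport g ⊆ Icc (-b) b) (hodd : ∀ t, g (-t) = -g t)
    (hb : Real.log q / 2 ≤ b) (hK : ∀ u ∈ Icc (Real.log q - b) b, ‖g u‖ ≤ K) :
    contribution q g ≤ 4 * (Real.log q / Real.sqrt q) * K ^ 2 * (b - Real.log q / 2) := by
  have hKnn : 0 ≤ K := (norm_nonneg _).trans (hK b ⟨by linarith, le_rfl⟩)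
  have hle : Real.log q - b ≤ b := by linarith
  have hint : (∫ u in Icc (Real.log q - b) b, ‖g u + g (Real.log q - u)‖ ^ 2) ≤
      ∫ u in Icc (Real.log q - b) b, (2 * K) ^ 2 := by
    refine setIntegral_mono_on (integrableOn_normSq_layer hg (· + ·) (by fun_prop) _ _ _)
      (continuous_const.continuousOn.integrableOn_Icc) measurableSet_Icc fun u hu ↦ ?_
    have hu' : Real.log q - u ∈ Icc (Real.log q - b) b := ⟨by linarith [hu.2], by linarith [hu.1]⟩
    have h1 : ‖g u + g (Real.log q - u)‖ ≤ 2 * K := (norm_add_le _ _).trans (by linarith [hK u hu, hK _ hu'])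
    exact pow_le_pow_left₀ (norm_nonneg _) h1 2
  rw [setIntegral_const, Real.volume_real_Icc_of_le hle, smul_eq_mul] at hint
  have hw : 0 ≤ Real.log q / (2 * Real.sqrt q) :=
    div_nonneg (Real.log_natCast_nonneg q) (mul_nonneg zero_le_two (Real.sqrt_nonneg _))
  calc contribution q g ≤ Real.log q / (2 * Real.sqrt q) * ∫ u in Icc (Real.log q - b) b, ‖g u + g (Real.log q - u)‖ ^ 2 :=
        contribution_odd_le_layer hg hsupp hodd
    _ ≤ Real.log q / (2 * Real.sqrt q) * ((b - (Real.log q - b)) * (2 * K) ^ 2) := mul_le_mul_of_nonneg_left hint hw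
    _ = 4 * (Real.log q / Real.sqrt q) * K ^ 2 * (b - Real.log q / 2) := by ring

/-! ## §3 On the window: the deleted form's even sector can only be cubically negative -/

/-- **Even floor of the deleted form**: on `q`'s window (`q < q'` consecutive, `(log q)/2 ≤ b ≤ (log q')/2`), for even `g` on `[−b, b]` with
slope `≤ M` on the layer, `Re Q_{S_q}(g) ≥ Re Q(g) − (4/3)(log q/√q)·M²·δ³`. [this track; window identity: Connes1999 §VII Thm 4 / HandoffWindow] -/
theorem re_semilocal_ge_of_even_slope (h : ConsecutivePrimes q q') (hg : IsWeilTest g) (hb : Real.log q / 2 ≤ b)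
    (hb' : b ≤ Real.log q' / 2) (hsupp : tsupport g ⊆ Icc (-b) b) (hev : ∀ t, g (-t) = g t)
    (hM : ∀ u ∈ Icc (Real.log q - b) b, ‖deriv g u‖ ≤ M) :
    (weilQuadratic g).re - 4 / 3 * (Real.log q / Real.sqrt q) * M ^ 2 * (b - Real.log q / 2) ^ 3 ≤
      (weilSemilocalQuadratic (Nat.primesBelow q) g).re := by
  have hid := re_weilQuadratic_eq_contribution_sub_deficit h hg (hsupp.trans (Icc_subset_Icc (neg_le_neg hb') hb'))
  unfold deficit at hid
  linarith [contribution_even_le_cubic hg hsupp hev hb hM]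

/-- **Odd floor of the deleted form** (linear): `Re Q_{S_q}(g) ≥ Re Q(g) − 4(log q/√q)·K²·δ` for odd `g` with `‖g‖ ≤ K` on the layer. [this track] -/
theorem re_semilocal_ge_of_odd_sup (h : ConsecutivePrimes q q') (hg : IsWeilTest g) (hb : Real.log q / 2 ≤ b)
    (hb' : b ≤ Real.log q' / 2) (hsupp : tsupport g ⊆ Icc (-b) b) (hodd : ∀ t, g (-t) = -g t)
    (hK : ∀ u ∈ Icc (Real.log q - b) b, ‖g u‖ ≤ K) :
    (weilQuadratic g).re - 4 * (Real.log q / Real.sqrt q) * K ^ 2 * (b - Real.log q / 2) ≤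
      (weilSemilocalQuadratic (Nat.primesBelow q) g).re := by
  have hid := re_weilQuadratic_eq_contribution_sub_deficit h hg (hsupp.trans (Icc_subset_Icc (neg_le_neg hb') hb'))
  unfold deficit at hid
  linarith [contribution_odd_le_linear hg hsupp hodd hb hK]

/-- **Under the even certificate the even deficit is at most cubic**: with `0 ≤ ε_ev(b)` (the A1/A4 ladder's even cell at any `c ≥ b`, or RH),
an even `g` on `[−b, b]` in `q`'s window with slope `≤ M` on the layer has `Re Q_{S_q}(g) ≥ ε_ev(b)‖g‖₂² − (4/3)(log q/√q)M²δ³ ≥ −(4/3)(log q/√q)M²δ³`.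
[this track; Bombieri2000Weil §4 Problem 2 (Rayleigh bound)] -/
theorem re_semilocal_ge_neg_cubic_of_even (h : ConsecutivePrimes q q') (hg : IsWeilTest g) (hb : Real.log q / 2 ≤ b)
    (hb' : b ≤ Real.log q' / 2) (hsupp : tsupport g ⊆ Icc (-b) b) (hev : ∀ t, g (-t) = g t)
    (hM : ∀ u ∈ Icc (Real.log q - b) b, ‖deriv g u‖ ≤ M) (hε : 0 ≤ weilEvenGroundEnergy b) :
    weilEvenGroundEnergy b * (∫ t : ℝ, ‖g t‖ ^ 2) - 4 / 3 * (Real.log q / Real.sqrt q) * M ^ 2 * (b - Real.log q / 2) ^ 3 ≤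
      (weilSemilocalQuadratic (Nat.primesBelow q) g).re ∧
    -(4 / 3 * (Real.log q / Real.sqrt q) * M ^ 2 * (b - Real.log q / 2) ^ 3) ≤
      (weilSemilocalQuadratic (Nat.primesBelow q) g).re := by
  have h1 := re_semilocal_ge_of_even_slope h hg hb hb' hsupp hev hM
  have h2 := weilEvenGroundEnergy_mul_le_re hg hsupp hev
  have hN : 0 ≤ ∫ t : ℝ, ‖g t‖ ^ 2 := integral_nonneg fun _ ↦ by positivity
  have h3 : 0 ≤ weilEvenGroundEnergy b * ∫ t : ℝ, ‖g t‖ ^ 2 := mul_nonneg hε hN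
  exact ⟨by linarith, by linarith⟩

/-- **An even NEGATIVE WITNESS needs slope**: if `Re Q_{S_q}(g) < 0` for an even `g` on `[−b, b]` in `q`'s window and `0 ≤ ε_ev(b)`, then any slope
bound `M` on the layer satisfies `(3/4)(√q/log q)·(ε_ev(b)‖g‖₂² − Re Q_{S_q}(g)) ≤ M²δ³`; in particular `M²δ³ > 0` — the witness is not flat on the
layer at scale `δ` (the quantitative companion of XII-p's node). [this track] -/
theorem slope_lower_bound_of_even_neg (h : ConsecutivePrimes q q') (hg : IsWeilTest g) (hb : Real.log q / 2 ≤ b)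
    (hb' : b ≤ Real.log q' / 2) (hsupp : tsupport g ⊆ Icc (-b) b) (hev : ∀ t, g (-t) = g t)
    (hM : ∀ u ∈ Icc (Real.log q - b) b, ‖deriv g u‖ ≤ M) (hε : 0 ≤ weilEvenGroundEnergy b)
    (hneg : (weilSemilocalQuadratic (Nat.primesBelow q) g).re < 0) :
    0 < 4 / 3 * (Real.log q / Real.sqrt q) * M ^ 2 * (b - Real.log q / 2) ^ 3 ∧
    weilEvenGroundEnergy b * (∫ t : ℝ, ‖g t‖ ^ 2) - (weilSemilocalQuadratic (Nat.primesBelow q) g).re ≤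
      4 / 3 * (Real.log q / Real.sqrt q) * M ^ 2 * (b - Real.log q / 2) ^ 3 := by
  have h1 := re_semilocal_ge_neg_cubic_of_even h hg hb hb' hsupp hev hM hε
  exact ⟨by linarith [h1.2], by linarith [h1.1]⟩

/-- **Flat even functions are never negative witnesses at the entrance point**: at `b = (log q)/2` (offset `0`) the even sector of the deleted
form is `≥ Re Q(g)` for every even `g` — the cubic term vanishes (the layer is a point). [this track] -/
theorem re_semilocal_ge_re_weilQuadratic_of_even_entrance (h : ConsecutivePrimes q q') (hg : IsWeilTest g)
    (hsupp : tsupport g ⊆ Icc (-(Real.log q / 2)) (Real.log q / 2)) (hev : ∀ t, g (-t) = g t) :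
    (weilQuadratic g).re ≤ (weilSemilocalQuadratic (Nat.primesBelow q) g).re := by
  obtain ⟨C, hC⟩ : ∃ C : ℝ, ∀ u, ‖deriv g u‖ ≤ C := by
    have hcont : Continuous (deriv g) := hg.1.continuous_deriv (by simp)
    have hcs : HasCompactSupport (deriv g) := hg.2.deriv
    obtain ⟨C, hC⟩ := hcs.exists_bound_of_continuous hcont
    exact ⟨C, hC⟩
  have hqq : Real.log q / 2 ≤ Real.log q' / 2 := by
    have h0 : (0 : ℝ) < q := by exact_mod_cast h.1.pos
    have h1 : (q : ℝ) ≤ q' := by exact_mod_cast h.2.2.1.le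
    linarith [Real.log_le_log h0 h1]
  have h1 := re_semilocal_ge_of_even_slope h hg le_rfl hqq hsupp hev (M := C) (fun u _ ↦ hC u)
  simp only [sub_self, ne_eq, OfNat.ofNat_ne_zero, not_false_eq_true, zero_pow, mul_zero, sub_zero] at h1
  exact h1

end Summit.RiemannHypothesis.RiemannHypothesis.Theorems.HandoffEvenRescueCubic

end
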